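import Summits.BirchSwinnertonDyer.Rank1Residual.Additive.CyclotomicGoodReduction
import HarnessLib

/-!
# Additive classes X3/X4: Delbourgo's (G) ⟺ `ord_p j ≥ 0 ∧ e ∣ p − 1` — the dictionary is an equivalence

HONEST FRAMING (cell `b2b-bsdres`, run/shared/lean/b2b/bsd-rank1-residual/, verbatim in every
file): the goal of the cell is to DELETE the COMBINATION-SHAPED residual classes of the
Birch–Swinnerton-Dyer formula for ALL analytic-rank `≤ 1` elliptic curves over `ℚ` — "full BSD
formula for every rank `≤ 1` curve in class `C`" assembled STRICTLY from published theorems — so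
that the rank-`≤ 1` remainder becomes exactly the CONSTRUCTION-SHAPED classes, which are TYPED
(missing-input `Prop`s), NOT attempted. This is not "finishing BSD". Sub-cell `additive-p2`
(X3/X4 at an additive prime, potentially good ORDINARY half): research route; no claim beyond the
stated classes; theorems only, no named fact.

`CyclotomicGoodReduction.lean` proved "data ⇒ (G)": `ord_p j ≥ 0 ∧ 12 ∣ (p−1)·ord_p Δ ⇒ TypeG W p`
(`p ≥ 5`); `TypeGIntegralJ.lean` proved (G) ⇒ `ord_p j ≥ 0`. This file proves the remaining
converse **(G) ⇒ `12 ∣ (p − 1)·ord_p Δ`** (`twelve_dvd_of_typeG`, any model, any `p`), so that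
Delbourgo's hypothesis (G) (Compositio 113 (1998) §1.5) and the census's data cell agree EXACTLY:

* `exists_valuation_Δ_eq_exp_twelve_mul_of_hasGoodReductionAt` — good reduction at `w` forces
  `ord_w Δ ∈ 12ℤ` for every model (a minimal model has unit discriminant, `Δ_X = u⁻¹²Δ`);
* `ramificationIdx_dvd_sub_one_of_intermediateField_cyclotomic` — for `F ⊆ ℚ(ζ_p)` and `w ∣ p`,
  `e(w|p) ∣ p − 1` (tower formula + total ramification `e(𝔓|p) = p − 1`, both Mathlib);
* `twelve_dvd_of_typeG` — (G) ⇒ `12 ∣ (p−1)·ord_p Δ` (`ord_w Δ = e(w|p)·ord_p Δ`, `valuation_liesOver`);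
* `semistabilityIndex_dvd_iff` — `e ∣ p − 1 ⟺ 12 ∣ (p−1)·ord_p Δ_min`, `e = 12/gcd(12, ord_p Δ_min)`;
* **`typeG_iff_padicValRat`** — `p ≥ 5`: `TypeG W p ↔ 0 ≤ ord_p j ∧ 12 ∣ (p−1)·ord_p Δ`;
* **`typeG_iff_not_subM_and_semistabilityIndex_dvd`** — `p ≥ 5`, `W` globally minimal:
  `TypeG W p ↔ ¬ SubM W p ∧ e ∣ p − 1` in additive-p4's census vocabulary
  (`SharpenedStatements.lean`); hence `SubGord W p ↔ TypeG W p ∧ CondExpTwo W p`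
  (`subGord_iff_typeG_and_condExpTwo`).

So at `p ≥ 5` the census cells (M) = `SubM` and (G) = `TypeG` are complementary inside
{`f_p = 2`} ∪ {pot. mult} exactly as SHARPENED-CONJECTURES §3 tabulates (M ∣ G-ord ∣ t′ ∣ w),
with (G-ord) ⊆ (G) and (t′) = tame ∧ ¬(G). The ORDINARY refinement `TypeGOrd` for `e ∈ {3,4,6}`
remains data-level (see `CyclotomicGoodReduction.lean`).

References: D. Delbourgo, Compositio Math. 113 (1998) §1.2 Lemma, §1.5 (G); J.-P. Serre,
J. Tate, Ann. of Math. 88 (1968) §2; J. H. Silverman, *AEC* VII.1 Prop. 1.3, VII.5.1;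
L. Washington, *Cyclotomic Fields*, Lemma 1.4, Prop. 2.3.
-/

noncomputable section

open scoped Classical NumberField

open WeierstrassCurve IsDedekindDomain IsDedekindDomain.HeightOneSpectrum NumberField
  Literature.NumberTheory.EllipticCurves Literature.NumberTheory.EllipticCurves.Rank1Residual

namespace Summit.BirchSwinnertonDyer.Rank1Residual.Additive

/-- **Good reduction forces `12 ∣ ord_w Δ`**: if `V/L` has good reduction at `w`, then the
`w`-adic valuation of the discriminant of ANY model `V` is a twelfth power in the value group,
`w(Δ_V) = w(u)¹²·(unit)` — precisely, `w(Δ_V) = exp(12 m)` for some `m ∈ ℤ`: a minimal model `X`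
at `w` has unit discriminant and `Δ_X = u⁻¹² Δ_V`. Silverman *AEC* VII.1 Prop. 1.3, Table 3.1. -/
theorem exists_valuation_Δ_eq_exp_twelve_mul_of_hasGoodReductionAt {L : Type*} [Field L]
    [NumberField L] (V : WeierstrassCurve L) [V.IsElliptic] (w : HeightOneSpectrum (𝓞 L))
    (hgood : V.HasGoodReductionAt w) : ∃ m : ℤ, w.valuation L V.Δ = WithZero.exp (12 * m) := by
  haveI : (V.localMinimalModel w).IsElliptic := V.isElliptic_localMinimalModel w
  have hg : (V.localMinimalModel w).HasGoodReduction (w.adicCompletionIntegers L) := hgood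
  set C : VariableChange (w.adicCompletion L) :=
    ((V.baseChange (w.adicCompletion L)).exists_isMinimal (w.adicCompletionIntegers L)).choose
    with hCdef
  have hXΔ : (V.localMinimalModel w).Δ =
      (↑C.u⁻¹ : w.adicCompletion L) ^ 12 * algebraMap L (w.adicCompletion L) V.Δ := by
    show (C • V.baseChange (w.adicCompletion L)).Δ = _
    rw [variableChange_Δ, baseChange, map_Δ]
  set val := (IsDiscreteValuationRing.maximalIdeal (w.adicCompletionIntegers L)).valuation
    (w.adicCompletion L) with hval
  have hΔ1 : val (V.localMinimalModel w).Δ = 1 := hg.goodReduction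
  have hu0 : (↑C.u : w.adicCompletion L) ≠ 0 := C.u.ne_zero
  -- `val(Δ_V) = val(u)¹²` on the completion
  have hkey : val (algebraMap L (w.adicCompletion L) V.Δ) =
      val ((↑C.u : w.adicCompletion L) ^ 12) := by
    rw [hXΔ, map_mul, map_pow, Units.val_inv_eq_inv_val, map_inv₀] at hΔ1
    have hvu : val (↑C.u : w.adicCompletion L) ≠ 0 := (Valuation.ne_zero_iff _).mpr hu0
    rw [map_pow]
    calc val (algebraMap L (w.adicCompletion L) V.Δ)
        = (val ↑C.u) ^ 12 * ((val ↑C.u)⁻¹ ^ 12 * val (algebraMap L (w.adicCompletion L) V.Δ)) := by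
          rw [← mul_assoc, ← mul_pow, mul_inv_cancel₀ hvu, one_pow, one_mul]
      _ = (val ↑C.u) ^ 12 := by rw [hΔ1, mul_one]
  -- transfer to `Valued.v`, where values are `exp` of integers, then to `w.valuation L`
  have hE := Literature.NumberTheory.EllipticCurves.isEquiv_valuation_maximalIdeal_valued w
  have hkey' : (Valued.v : Valuation (w.adicCompletion L) (WithZero (Multiplicative ℤ)))
      (algebraMap L (w.adicCompletion L) V.Δ) =
      (Valued.v : Valuation (w.adicCompletion L) (WithZero (Multiplicative ℤ)))
      ((↑C.u : w.adicCompletion L) ^ 12) := (hE.eq_iff).mp hkey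
  have hvu' : (Valued.v : Valuation (w.adicCompletion L) (WithZero (Multiplicative ℤ)))
      (↑C.u : w.adicCompletion L) ≠ 0 := (Valuation.ne_zero_iff _).mpr hu0
  refine ⟨WithZero.log ((Valued.v : Valuation (w.adicCompletion L) (WithZero (Multiplicative ℤ)))
      (↑C.u : w.adicCompletion L)), ?_⟩
  rw [← valuedAdicCompletion_eq_valuation' w V.Δ]
  change (Valued.v : Valuation (w.adicCompletion L) (WithZero (Multiplicative ℤ)))
      (algebraMap L (w.adicCompletion L) V.Δ) = _
  rw [hkey', map_pow, ← WithZero.exp_log hvu', ← WithZero.exp_nsmul, WithZero.exp_log hvu']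
  congr 1

/-- **In a subfield `F` of a `p`-th cyclotomic field, the ramification index of a prime `w ∣ p`
divides `p − 1`**: choose a prime `𝔓` of `ℚ(ζ_p) ⊇ F` above `w`; then
`e(𝔓|p) = e(w|p)·e(𝔓|w)` (Mathlib `Ideal.ramificationIdx'_algebra_tower`) and `e(𝔓|p) = p − 1`
(total ramification, Mathlib `IsCyclotomicExtension.Rat.ramificationIdx_eq_of_prime_pow`).
Washington, *Cyclotomic Fields*, Prop. 2.3 / Lemma 1.4. -/
theorem ramificationIdx_dvd_sub_one_of_intermediateField_cyclotomic {L : Type} [Field L]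
    [NumberField L] (p : ℕ) [hp : Fact p.Prime] [hcyc : IsCyclotomicExtension {p} ℚ L]
    (F : IntermediateField ℚ L) (w : HeightOneSpectrum (𝓞 F))
    [hw : w.asIdeal.LiesOver (Ideal.span {(p : ℤ)})] :
    (Ideal.span {(p : ℤ)}).ramificationIdx' w.asIdeal ∣ p - 1 := by
  haveI : NumberField F := NumberField.of_module_finite ℚ F
  haveI hcyc' : IsCyclotomicExtension {p ^ (0 + 1)} ℚ L := by
    rw [zero_add, pow_one]; exact hcyc
  -- a prime of `𝓞 L` above `w`
  haveI := w.isMaximal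
  obtain ⟨Q, hQmax, hQover⟩ :=
    Ideal.exists_maximal_ideal_liesOver_of_isIntegral (S := 𝓞 L) w.asIdeal
  haveI := hQover
  haveI : Q.IsPrime := hQmax.isPrime
  haveI : Q.LiesOver (Ideal.span {(p : ℤ)}) := Ideal.LiesOver.trans Q w.asIdeal _
  have hpbot : Ideal.span {(p : ℤ)} ≠ ⊥ := by
    rw [Ne, Ideal.span_singleton_eq_bot]; exact_mod_cast hp.out.ne_zero
  -- `e(𝔓|p) = p − 1`
  have heL : (Ideal.span {(p : ℤ)}).ramificationIdx' Q = p - 1 := by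
    rw [Ideal.ramificationIdx'_eq_ramificationIdx _ _ hpbot,
      IsCyclotomicExtension.Rat.ramificationIdx_eq_of_prime_pow p 0 L Q, pow_zero, one_mul]
  -- tower
  have hg0 : Ideal.map (algebraMap (𝓞 F) (𝓞 L)) w.asIdeal ≠ ⊥ := by
    rw [Ne, Ideal.map_eq_bot_iff_of_injective (RingOfIntegers.algebraMap.injective F L)]
    exact w.ne_bot
  have hfg : Ideal.map (algebraMap ℤ (𝓞 L)) (Ideal.span {(p : ℤ)}) ≠ ⊥ :=
    Ideal.map_ne_bot_of_ne_bot hpbot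
  have hg : Ideal.map (algebraMap (𝓞 F) (𝓞 L)) w.asIdeal ≤ Q :=
    Ideal.map_le_iff_le_comap.mpr (le_of_eq (hQover.over))
  have htower := Ideal.ramificationIdx'_algebra_tower (p := Ideal.span {(p : ℤ)}) hg0 hfg hg
  rw [heL] at htower
  exact Dvd.intro _ htower.symm

/-- **Type (G) forces `12 ∣ (p − 1)·ord_p Δ`** (any model `W/ℚ`, any prime `p`): if `E_F` has good
reduction above `p` for a subfield `F ⊆ ℚ(ζ_p)` then, at a place `w ∣ p` of `F`,
`ord_w Δ = e(w|p)·ord_p Δ ∈ 12ℤ` (`exists_valuation_Δ_eq_exp_twelve_mul_of_hasGoodReductionAt`,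
`valuation_liesOver`) and `e(w|p) ∣ p − 1`
(`ramificationIdx_dvd_sub_one_of_intermediateField_cyclotomic`). With
`typeG_of_padicValRat_j_nonneg_of_twelve_dvd` (sibling file `CyclotomicGoodReduction.lean`) and
`padicValRat_j_nonneg_of_typeG` this makes the kernel dictionary an EQUIVALENCE at `p ≥ 5`:
(G) ⟺ `ord_p j ≥ 0 ∧ 12 ∣ (p−1)·ord_p Δ` ⟺ `ord_p j ≥ 0 ∧ e ∣ p − 1`. -/
theorem twelve_dvd_of_typeG (W : WeierstrassCurve ℚ) [W.IsElliptic] (p : ℕ) [hp : Fact p.Prime]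
    (h : TypeG W p) : (12 : ℤ) ∣ ((p : ℤ) - 1) * padicValRat p W.Δ := by
  obtain ⟨L, _, _, hcycL, F, hF⟩ := h
  haveI : NumberField F := NumberField.of_module_finite ℚ F
  obtain ⟨w, hw⟩ := exists_heightOneSpectrum_natCast_mem F p
  haveI : (W.baseChange F).IsElliptic := by rw [baseChange]; infer_instance
  obtain ⟨m, hm⟩ :=
    exists_valuation_Δ_eq_exp_twelve_mul_of_hasGoodReductionAt (W.baseChange F) w (hF w hw)
  have hΔF : (W.baseChange F).Δ = algebraMap ℚ F W.Δ := by rw [baseChange, map_Δ]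
  have hΔ0 : W.Δ ≠ 0 := W.isUnit_Δ.ne_zero
  -- the place of `ℤ` below `w` is `(p)`
  set v : HeightOneSpectrum ℤ := (Rat.HeightOneSpectrum.primesEquiv (R := ℤ)).symm ⟨p, hp.out⟩
    with hvdef
  have hv : Rat.HeightOneSpectrum.natGenerator v = p :=
    congrArg Subtype.val ((Rat.HeightOneSpectrum.primesEquiv (R := ℤ)).apply_symm_apply ⟨p, hp.out⟩)
  have hvspan : v.asIdeal = Ideal.span {(p : ℤ)} := by
    rw [Rat.HeightOneSpectrum.asIdeal_eq_span_natGenerator_int, hv]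
  have hunder : w.asIdeal.under ℤ = v.asIdeal := by
    have hle : v.asIdeal ≤ w.asIdeal.under ℤ := by
      rw [hvspan, Ideal.span_le, Set.singleton_subset_iff, SetLike.mem_coe, Ideal.under_def,
        Ideal.mem_comap, map_natCast]
      exact hw
    exact (v.isMaximal.eq_of_le (Ideal.IsPrime.ne_top inferInstance) hle).symm
  haveI hlies : w.asIdeal.LiesOver v.asIdeal := ⟨hunder.symm⟩
  haveI hlies' : w.asIdeal.LiesOver (Ideal.span {(p : ℤ)}) := by rw [← hvspan]; exact hlies
  -- `e(w|p) ∣ p − 1`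
  have hedvd : v.asIdeal.ramificationIdx' w.asIdeal ∣ p - 1 := by
    rw [hvspan]
    exact ramificationIdx_dvd_sub_one_of_intermediateField_cyclotomic p F w
  obtain ⟨c, hc⟩ := hedvd
  -- `e(w|p)·ord_p Δ = −12 m`
  have hval := valuation_liesOver (K := ℚ) (L := F) v w W.Δ
  rw [Rat.HeightOneSpectrum.valuation_eq_exp_neg_padicValRat v hΔ0, hv, ← hΔF, hm,
    ← WithZero.exp_nsmul, WithZero.exp_inj, nsmul_eq_mul] at hval
  -- conclude
  have h1 : ((p : ℤ) - 1) = ((v.asIdeal.ramificationIdx' w.asIdeal : ℕ) : ℤ) * (c : ℤ) := by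
    have := hp.out.one_lt.le
    have h' : ((p - 1 : ℕ) : ℤ) = (p : ℤ) - 1 := by omega
    rw [← h', hc]; push_cast; ring
  rw [h1]
  exact ⟨-(m * c), by linear_combination (-(c : ℤ)) * hval⟩

/-- **`e ∣ p − 1 ⟺ 12 ∣ (p − 1)·ord_p Δ_min`** for the census's semistability index
`e = 12 / gcd(12, ord_p Δ_min)` (`semistabilityIndex`): with `g = gcd(12, v)`, `12 = e·g`,
`v = (v/g)·g` and `gcd(e, v/g) = 1`. -/
theorem semistabilityIndex_dvd_iff (W : WeierstrassCurve ℚ) [W.IsElliptic] [W.IsGloballyMinimal]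
    (p : ℕ) [Fact p.Prime] :
    semistabilityIndex W p ∣ p - 1 ↔ 12 ∣ (p - 1) * padicValInt p W.minimalDiscriminantInt := by
  set v := padicValInt p W.minimalDiscriminantInt with hv
  have hg12 : Nat.gcd 12 v ∣ 12 := Nat.gcd_dvd_left 12 v
  have hgv : Nat.gcd 12 v ∣ v := Nat.gcd_dvd_right 12 v
  have hgpos : 0 < Nat.gcd 12 v := Nat.gcd_pos_of_pos_left v (by norm_num)
  have he : semistabilityIndex W p * Nat.gcd 12 v = 12 := by
    show 12 / Nat.gcd 12 v * Nat.gcd 12 v = 12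
    exact Nat.div_mul_cancel hg12
  have hvg : v / Nat.gcd 12 v * Nat.gcd 12 v = v := Nat.div_mul_cancel hgv
  constructor
  · intro h
    have h1 : 12 ∣ (p - 1) * Nat.gcd 12 v := by
      have h2 := Nat.mul_dvd_mul_right h (Nat.gcd 12 v)
      rwa [he] at h2
    exact dvd_trans h1 (Nat.mul_dvd_mul_left _ hgv)
  · intro h
    have hcop : Nat.Coprime (12 / Nat.gcd 12 v) (v / Nat.gcd 12 v) :=
      Nat.coprime_div_gcd_div_gcd hgpos
    have h1 : semistabilityIndex W p * Nat.gcd 12 v ∣ (p - 1) * (v / Nat.gcd 12 v) * Nat.gcd 12 v := by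
      rw [he, mul_assoc, hvg]; exact h
    have h2 : semistabilityIndex W p ∣ (p - 1) * (v / Nat.gcd 12 v) :=
      Nat.dvd_of_mul_dvd_mul_right hgpos h1
    exact hcop.dvd_of_dvd_mul_right h2

/-- The `ℚ`-model form of the divisibility: for a globally minimal `W`,
`12 ∣ (p − 1)·ord_p Δ(W)` (in `ℤ`, `ord_p` of the rational `Δ`) iff `12 ∣ (p − 1)·ord_p Δ_min`. -/
theorem twelve_dvd_padicValRat_Δ_iff (W : WeierstrassCurve ℚ) [W.IsElliptic]
    [W.IsGloballyMinimal] (p : ℕ) [hp : Fact p.Prime] :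
    (12 : ℤ) ∣ ((p : ℤ) - 1) * padicValRat p W.Δ ↔
      12 ∣ (p - 1) * padicValInt p W.minimalDiscriminantInt := by
  rw [← cast_minimalDiscriminantInt W, padicValRat.of_int]
  have h1 : ((p - 1 : ℕ) : ℤ) = (p : ℤ) - 1 := by
    have := hp.out.one_lt.le
    omega
  rw [← h1]
  exact_mod_cast Int.natCast_dvd_natCast

/-! ### The dictionary is an equivalence -/

/-- **Delbourgo's (G) ⟺ `ord_p j ≥ 0 ∧ 12 ∣ (p − 1)·ord_p Δ`** (`p ≥ 5`, any model `W/ℚ`):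
`typeG_of_padicValRat_j_nonneg_of_twelve_dvd` (⇐), `padicValRat_j_nonneg_of_typeG` and
`twelve_dvd_of_typeG` (⇒). -/
theorem typeG_iff_padicValRat (W : WeierstrassCurve ℚ) [W.IsElliptic] (p : ℕ) [Fact p.Prime]
    (hp5 : 5 ≤ p) :
    TypeG W p ↔ 0 ≤ padicValRat p W.j ∧ (12 : ℤ) ∣ ((p : ℤ) - 1) * padicValRat p W.Δ :=
  ⟨fun h => ⟨padicValRat_j_nonneg_of_typeG W p h, twelve_dvd_of_typeG W p h⟩,
    fun h => typeG_of_padicValRat_j_nonneg_of_twelve_dvd W p hp5 h.1 h.2⟩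

/-- **(G) ⟺ ¬(M) ∧ `e ∣ p − 1`** in the census vocabulary of `SharpenedStatements.lean`
(`p ≥ 5`, `W` globally minimal): Delbourgo's type (G) is exactly "not potentially multiplicative
and the semistability index divides `p − 1`". -/
theorem typeG_iff_not_subM_and_semistabilityIndex_dvd (W : WeierstrassCurve ℚ) [W.IsElliptic]
    [W.IsGloballyMinimal] (p : ℕ) [Fact p.Prime] (hp5 : 5 ≤ p) :
    TypeG W p ↔ ¬ SubM W p ∧ semistabilityIndex W p ∣ p - 1 := by
  rw [typeG_iff_padicValRat W p hp5, twelve_dvd_padicValRat_Δ_iff, ← semistabilityIndex_dvd_iff]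
  simp only [SubM, PotMult, not_lt]

/-- **The census cell (G-ord) = (G) ∩ {f_p = 2}** at `p ≥ 5` (`W` globally minimal):
`SubGord W p ↔ TypeG W p ∧ CondExpTwo W p`. -/
theorem subGord_iff_typeG_and_condExpTwo (W : WeierstrassCurve ℚ) [W.IsElliptic]
    [W.IsGloballyMinimal] (p : ℕ) [Fact p.Prime] (hp5 : 5 ≤ p) :
    SubGord W p ↔ TypeG W p ∧ CondExpTwo W p := by
  rw [typeG_iff_not_subM_and_semistabilityIndex_dvd W p hp5]
  unfold SubGord SubM
  tauto

/-- Both halves of additive-p4's split of the (G-ord) cell — `SubGordTwo` (e = 2, Kodaira `I₀*`)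
and `SubGordHigher` (e ∈ {3,4,6}) — are of Delbourgo type (G) at `p ≥ 5`. -/
theorem typeG_of_subGordTwo (W : WeierstrassCurve ℚ) [W.IsElliptic] [W.IsGloballyMinimal]
    (p : ℕ) [Fact p.Prime] (hp5 : 5 ≤ p) (h : SubGordTwo W p) : TypeG W p :=
  typeG_of_subGord W p hp5 h.1

/-- See `typeG_of_subGordTwo`. -/
theorem typeG_of_subGordHigher (W : WeierstrassCurve ℚ) [W.IsElliptic] [W.IsGloballyMinimal]
    (p : ℕ) [Fact p.Prime] (hp5 : 5 ≤ p) (h : SubGordHigher W p) : TypeG W p :=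
  typeG_of_subGord W p hp5 h.1

end Summit.BirchSwinnertonDyer.Rank1Residual.Additive

end
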